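import Summits.QuantumFields.BalabanUV.T4Continuum.Support.ShellMeasureMultiGridNorms
import Summits.QuantumFields.BalabanUV.T4Continuum.Support.ShellMeasureDecayKernelSums
import Literature.MathematicalPhysics.QuantumFieldTheory.Balaban1983to89.T4ShellMeasureFibre

/-!
# `T4Continuum.ShellMeasurePinnedNorm` — PINNED DECAY NORMS: the engine of the LOCALITY ROAD for END-II
# (owner finding F-ne7cp1-g30-1 «END-II of record is locality-blind»)
(cell `pub-balaban`, sub-cell `t4`, spine estimate NE7c (node U5b); owner lineage `b2b-balaban-t4-ne7c-p1`, gen 30,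
row S69 of `t4/b2b-balaban-t4-ne7c-p1/LEAVES-NE7c-P1.md`; ADDITIVE — imports S65 f2a `ShellMeasureMultiGridNorms`
(p222079: the weighted sup spaces `WSup w α 𝔄`), S66 f3a `ShellMeasureDecayKernelSums` (p221973: `kerOp`, decay ⇒ row
sums, the torus engine) and the Literature leaf `T4ShellMeasureFibre` (`slotAntiConcentration_mono`) ONLY; [folklore];
3 DATA defs (`pinW`, `kerOpPin`, `pinDist`), 0 `def … : Prop`, 0 sorry, 0 citations)

HONEST FRAMING.  Finite four-torus programme, rung (B)+1 only — NOT infinite volume, NOT a mass gap, NOT the Clay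
problem, NOT summit progress; (B), `BetaPertHyp`, (B^μ) not consumed.  NE7c (`T4IndicatorShell.ShellWeightBound`) is NOT
PRINTED in [Balaban 1983–89] and NOT PROVED; «NE7c ⇐ the named binders» (trigger c3).  Nothing printed is asserted
here; no estimate of Bałaban's is discharged; this file is functional-analytic PLUMBING on finite index sets.

THE FINDING THIS FILE SERVES (GAPS F-ne7cp1-g30-1, owner gen 30 — an audit of OUR wiring, not of print).  END-II of
record (`ShellMeasureLandauHolonomyPrint.slotAC_realized_su2_landauChart_print` and every `…landauChart*` END, over
`ShellMeasureLevelAssembly.slotAntiConcentration_of_levelData`) concludes (M1) with the slot constant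
`D = 2(m₀ + β·Σ_{p∈P_w} L̄_p(d̄_p + 4s̄_p) + B_𝓔)∕(1−δ)`, `B_𝓔 = 3H̄∕(r_Φ∕S − 1)`, `H̄ ≥ Σ_{i∈I} 2e_i`, where the LD END
feeds p-UNIFORM letter data (`L̄_p = m_w·3κ_w z̄∕(Rad − 1)`, `s̄_p = m_w κ_w z̄`) and i-UNIFORM sup bounds `e_i`.  Its
dictionary `hRdict` is an EQUALITY «density's block section = J · weight(words of the exponent field) · e^{−𝓔}» with
`J ≤ 1` centre-monotone.  At a LIVE level `j ≥ 1` the Gibbs factor of ONE term of [Balaban1988Convergent] (2.18) is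
`exp A_j(g_j^{−2}, U_j(V))` with the GLOBAL minimiser `U_j(V)` — every fine plaquette's holonomy and every localized
term moves with the block variables (with exponentially small amplitude far away), so inhabiting `hRdict` forces
`P_w ⊇` {all fine plaquettes of the action} and `I ⊇` {all localized terms}: with p-∕i-UNIFORM data `D_j ∝` VOLUME, and
END-I's binder (j) `D_j ≤ D̄` (K- and volume-uniform; WALL v1.8 §2 (j) «block geometry `#P_w ≤ f(d,M,L)`») is NOT
inhabitable through END-II as typed.  Level 0 is exempt (far factors do not move: `P_all = P_ext ∪ P_w`,
`ShellMeasureWilsonLedger`).  What makes the true ray cost O(1) is the DECAY half of the propagator∕minimiser bounds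
([Balaban1985BackgroundPropagators] (3.133)∕Thm 3.3, [Balaban1985Variational] (73), (190): kernels `≤ B₀·e^{−δ₀d}`),
for which END-II — displaying only the sup constants `B₀` — has NO SLOT.  THE REPAIR (locality road, rows S69–S71):
read the VARIATION of the exponent field along the chart ray in a PINNED norm (this file), so that per-plaquette and
per-term ray costs DECAY with the distance to the block and their sums are volume-free; `slotAntiConcentration_of_
levelData`'s PER-PLAQUETTE currency hosts this verbatim (§5).

WHAT IS PROVED ([folklore]).
* §1 `pinW δ′ ϖ b = e^{δ′ϖ b}` (DATA) — the block-centred weight on S65's `WSup`; `norm_apply_le_exp_neg`: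
  `‖A b‖ ≤ e^{−δ′ϖ b}·‖A‖_pin`.
* §2 **DECAYING KERNEL ⇒ PINNED OPERATOR BOUND** (`pinned_rowSum_le`, `kerOpPin`, `norm_kerOpPin_apply_le`,
  `opNorm_kerOpPin_le`): `‖k c b‖ ≤ c₀e^{−δρ(c,b)}`, a pin profile ONE-SIDED LIPSCHITZ for `ρ` (`ϖ x ≤ ϖ y + ρ x y`),
  `0 ≤ δ′`, and the uniform exponential sum at the REDUCED rate `Σ_b e^{−(δ−δ′)ρ(x, b)} ≤ M` ⟹ `kerOp k` maps
  `(fields, pin δ′)` to `(fields, pin δ′)` with norm `≤ c₀·M` — S66 f3a's row-sum engine conjugated by the weight.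
* §3 **LOCATED READ-OUTS SEE THE PIN** (`norm_trunc_le`, `norm_readOut_le_of_blind`, `norm_sub_le_of_blind_lipschitz`):
  a (linear or Lipschitz) functional blind off a finite support at pin-depth `≥ r` reads `≤ ‖ℓ‖·e^{−δ′r}·‖A‖_pin`.
* §4 **LOCATED SUMS ARE VOLUME-FREE** (`sum_mul_le_of_pinned`; torus instance `pinDist`, `pinDist_le_add`,
  `exp_neg_pinDist_le_sum`, `sum_exp_neg_pinDist_le`): per-index costs `L p ≤ ℓ₀e^{−δ′ϖ(pos p)}` against sizes `≤ ḡ`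
  sum to `≤ ℓ₀·ḡ·K` once `Σ_p e^{−δ′ϖ(pos p)} ≤ K`; on the torus `(ℤ∕Tℤ)ᵈ` with the pin = ℓ¹-distance to a finite site
  set `B₀` and at most `m` indices per site, `K = #B₀·m·K₁ d δ′` — NO volume, NO `T` (S66 f3a `sum_exp_pl1_comp_le'`).
* §5 **THE END SHAPE** (`weightBudget_le`, `slotAntiConcentration_pinned`): (M1) with
  `ShellMeasureLevelAssembly.slotAntiConcentration_of_levelData`'s constant `2(n + (β Σ_{p∈P_w} L̄_p(d̄_p + 4s̄_p) + B_𝓔))∕(1−δ)`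
  for ANY finite `P_w` (all plaquettes allowed) and pinned Lipschitz data `L̄_p ≤ ℓ₀e^{−δ′ϖ(pos p)}` passes to the
  VOLUME-FREE constant `2(n + (β·ℓ₀(d̄ + 4s̄)K + B_𝓔))∕(1−δ)` (`slotAntiConcentration_mono`).
LOCATED INPUTS OF THE ROAD (displayed in print with `δ₀`, NOT discharged, NOT asserted): the decay of the kernels of
`H`, `H₁` ((3.133)), `𝔊` (Thm 3.3∕3.13), `𝔇 = δD∕δA′` ((73)), and of `δU_k∕δV` ((190)) — consumed by S70 (the LD chain in
two norms ⇒ `‖Z_V(y) − Z_V(0)‖_pin ≤ z_pin`) and S71 (per-term oscillations into S16 `rayBound_of_analytic_terms`).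
NOTHING in the countdown moves; NE7c NOT PROVED; spine PROVED 0∕9.  HONEST DEPENDENCY (cell): continuum YM on T⁴ ⇐
BetaPertH ∧ nine spine estimates (0/9 proved); BetaPertH ⇐ (D1) ∧ (D4) ∧ CAP+tail; G-an2-4 gates asym, D1 and NE2/3/4.
-/

noncomputable section

open Metric Set Function

namespace Summit.QuantumFields.BalabanUV.T4Continuum.ShellMeasurePinnedNorm

open Literature.MathematicalPhysics.QuantumFieldTheory.Balaban1983to89
open Summit.QuantumFields.BalabanUV.T4Continuum.ShellMeasureMultiGridNorms (WSup)
open Summit.QuantumFields.BalabanUV.T4Continuum.ShellMeasureDecayKernelSums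
  (kerOp kerOp_apply sum_exp_pl1_comp_le')
open TreeLengthTorus (TPt)
open B12Decay510Torus (pl1 pl1_sub_triangle pl1_nonneg)
open B12Decay510Window (K₁)
open T4ShellMeasure (SlotAntiConcentration)
open T4ShellMeasureFibre (slotAntiConcentration_mono)

variable {Λ Λ' : Type*} {𝔄 𝔅 : Type*} [NormedAddCommGroup 𝔄] [NormedSpace ℂ 𝔄] [NormedAddCommGroup 𝔅]
  [NormedSpace ℂ 𝔅]

/-! ## §1 The pinned weight on S65's weighted sup spaces -/

/-- THE PINNED WEIGHT `e^{δ′·ϖ b}` of a pin profile `ϖ` (e.g. the distance of the index `b` to the block) at rate `δ′`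
(DATA). [folklore] -/
def pinW (δ' : ℝ) (ϖ : Λ → ℝ) : Λ → ℝ := fun b => Real.exp (δ' * ϖ b)

/-- Unfolding. [folklore] -/
@[simp] theorem pinW_apply (δ' : ℝ) (ϖ : Λ → ℝ) (b : Λ) : pinW δ' ϖ b = Real.exp (δ' * ϖ b) := rfl

/-- The pinned weight is positive. [folklore] -/
theorem pinW_pos (δ' : ℝ) (ϖ : Λ → ℝ) (b : Λ) : 0 < pinW δ' ϖ b := Real.exp_pos _

/-- … as the `Fact` instance S65's `WSup` norm asks for. [folklore] -/
instance instFactPinWPos (δ' : ℝ) (ϖ : Λ → ℝ) : Fact (∀ b, 0 < pinW δ' ϖ b) := ⟨pinW_pos δ' ϖ⟩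

section Component

variable [Fintype Λ]

/-- **EACH COMPONENT IS EXPONENTIALLY SMALL IN THE PIN DEPTH**: `‖A b‖ ≤ e^{−δ′ϖ b}·‖A‖_pin`. [folklore] -/
theorem norm_apply_le_exp_neg (δ' : ℝ) (ϖ : Λ → ℝ) (A : WSup (pinW δ' ϖ) 1 𝔄) (b : Λ) :
    ‖A b‖ ≤ Real.exp (-(δ' * ϖ b)) * ‖A‖ := by
  have h := WSup.norm_apply_le (pinW δ' ϖ) 1 A b
  rw [pow_one, pinW_apply] at h
  rw [Real.exp_neg, ← div_eq_inv_mul, le_div_iff₀ (Real.exp_pos _), mul_comm]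
  exact h

/-- The flat sup norm is below the pinned norm when the profile is nonnegative and `δ′ ≥ 0`. [folklore] -/
theorem norm_toPiL_le_of_nonneg {δ' : ℝ} (hδ' : 0 ≤ δ') {ϖ : Λ → ℝ} (hϖ : ∀ b, 0 ≤ ϖ b)
    (A : WSup (pinW δ' ϖ) 1 𝔄) : ‖WSup.toPiL (pinW δ' ϖ) 1 A‖ ≤ ‖A‖ := by
  refine (pi_norm_le_iff_of_nonneg (norm_nonneg _)).2 fun b => ?_
  rw [WSup.toPiL_apply]
  refine (norm_apply_le_exp_neg δ' ϖ A b).trans ?_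
  have h1 : Real.exp (-(δ' * ϖ b)) ≤ 1 := Real.exp_le_one_iff.2 (by nlinarith [hϖ b])
  exact (mul_le_mul_of_nonneg_right h1 (norm_nonneg _)).trans_eq (one_mul _)

end Component

/-! ## §2 Decaying kernel ⇒ pinned operator bound -/

section Kernel

variable [Fintype Λ] [Fintype Λ'] {S : Type*}

omit [Fintype Λ'] in
/-- **THE CONJUGATED ROW SUM.**  Kernel `‖k c b‖ ≤ c₀e^{−δρ(c,b)}`, pin profile `ϖ` with `ϖ x ≤ ϖ y + ρ x y`, `δ′ ≥ 0`,
reduced-rate exponential sums `Σ_b e^{−(δ−δ′)ρ(x, b)} ≤ M` ⟹ `Σ_b e^{δ′ϖ(c)}·‖k c b‖·e^{−δ′ϖ(b)} ≤ c₀·M`. [folklore] -/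
theorem pinned_rowSum_le (k : Λ' → Λ → (𝔄 →L[ℂ] 𝔅)) (ρ : S → S → ℝ) (posIn : Λ → S) (posOut : Λ' → S)
    (ϖ : S → ℝ) {c₀ δ δ' M : ℝ} (hc₀ : 0 ≤ c₀) (hδ' : 0 ≤ δ')
    (hk : ∀ c b, ‖k c b‖ ≤ c₀ * Real.exp (-(δ * ρ (posOut c) (posIn b))))
    (hϖ : ∀ x y, ϖ x ≤ ϖ y + ρ x y)
    (hM : ∀ x : S, ∑ b, Real.exp (-((δ - δ') * ρ x (posIn b))) ≤ M) (c : Λ') :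
    ∑ b, Real.exp (δ' * ϖ (posOut c)) * ‖k c b‖ * Real.exp (-(δ' * ϖ (posIn b))) ≤ c₀ * M := by
  calc ∑ b, Real.exp (δ' * ϖ (posOut c)) * ‖k c b‖ * Real.exp (-(δ' * ϖ (posIn b)))
      ≤ ∑ b, c₀ * Real.exp (-((δ - δ') * ρ (posOut c) (posIn b))) := Finset.sum_le_sum fun b _ => by
        have h1 : Real.exp (δ' * ϖ (posOut c)) * Real.exp (-(δ' * ϖ (posIn b))) ≤
            Real.exp (δ' * ρ (posOut c) (posIn b)) := by
          rw [← Real.exp_add]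
          exact Real.exp_le_exp.2 (by nlinarith [hϖ (posOut c) (posIn b)])
        calc Real.exp (δ' * ϖ (posOut c)) * ‖k c b‖ * Real.exp (-(δ' * ϖ (posIn b)))
            = ‖k c b‖ * (Real.exp (δ' * ϖ (posOut c)) * Real.exp (-(δ' * ϖ (posIn b)))) := by ring
          _ ≤ (c₀ * Real.exp (-(δ * ρ (posOut c) (posIn b)))) * Real.exp (δ' * ρ (posOut c) (posIn b)) :=
              mul_le_mul (hk c b) h1 (by positivity) (by positivity)
          _ = c₀ * Real.exp (-((δ - δ') * ρ (posOut c) (posIn b))) := by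
              rw [mul_assoc, ← Real.exp_add]; ring_nf
    _ = c₀ * ∑ b, Real.exp (-((δ - δ') * ρ (posOut c) (posIn b))) := by rw [Finset.mul_sum]
    _ ≤ c₀ * M := mul_le_mul_of_nonneg_left (hM (posOut c)) hc₀

/-- **THE KERNEL OPERATOR BETWEEN PINNED SPACES** (DATA): S66 f3a's `kerOp k` conjugated by S65's identity `toPiL`,
`(fields on Λ, pin δ′ ϖi) →L[ℂ] (fields on Λ′, pin δ′ ϖo)`. [folklore] -/
def kerOpPin (k : Λ' → Λ → (𝔄 →L[ℂ] 𝔅)) (δ' : ℝ) (ϖi : Λ → ℝ) (ϖo : Λ' → ℝ) :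
    WSup (pinW δ' ϖi) 1 𝔄 →L[ℂ] WSup (pinW δ' ϖo) 1 𝔅 :=
  ((WSup.toPiL (𝔄 := 𝔅) (pinW δ' ϖo) 1).symm.toContinuousLinearMap).comp
    ((kerOp k).comp (WSup.toPiL (𝔄 := 𝔄) (pinW δ' ϖi) 1).toContinuousLinearMap)

/-- Unfolding: `kerOpPin k δ′ ϖi ϖo A c = Σ_b k c b (A b)`. [folklore] -/
theorem kerOpPin_apply (k : Λ' → Λ → (𝔄 →L[ℂ] 𝔅)) (δ' : ℝ) (ϖi : Λ → ℝ) (ϖo : Λ' → ℝ)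
    (A : WSup (pinW δ' ϖi) 1 𝔄) (c : Λ') : kerOpPin k δ' ϖi ϖo A c = ∑ b, k c b (A b) := by
  simp only [kerOpPin, ContinuousLinearMap.coe_comp, ContinuousLinearEquiv.coe_coe, Function.comp_apply]
  rw [WSup.toPiL_symm_apply, kerOp_apply]
  rfl

/-- **DECAYING KERNEL ⇒ PINNED OPERATOR BOUND**: under the hypotheses of `pinned_rowSum_le`,
`‖kerOpPin k δ′ (ϖ∘posIn) (ϖ∘posOut) A‖_pin ≤ c₀·M·‖A‖_pin`. [folklore] -/
theorem norm_kerOpPin_apply_le (k : Λ' → Λ → (𝔄 →L[ℂ] 𝔅)) (ρ : S → S → ℝ) (posIn : Λ → S) (posOut : Λ' → S)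
    (ϖ : S → ℝ) {c₀ δ δ' M : ℝ} (hc₀ : 0 ≤ c₀) (hδ' : 0 ≤ δ') (hM0 : 0 ≤ M)
    (hk : ∀ c b, ‖k c b‖ ≤ c₀ * Real.exp (-(δ * ρ (posOut c) (posIn b))))
    (hϖ : ∀ x y, ϖ x ≤ ϖ y + ρ x y)
    (hM : ∀ x : S, ∑ b, Real.exp (-((δ - δ') * ρ x (posIn b))) ≤ M)
    (A : WSup (pinW δ' (ϖ ∘ posIn)) 1 𝔄) :
    ‖kerOpPin k δ' (ϖ ∘ posIn) (ϖ ∘ posOut) A‖ ≤ c₀ * M * ‖A‖ := by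
  refine (WSup.norm_le_iff (pinW δ' (ϖ ∘ posOut)) 1 (by positivity)).2 fun c => ?_
  rw [pow_one, pinW_apply, kerOpPin_apply]
  have hcomp : ∀ b, ‖A b‖ ≤ Real.exp (-(δ' * ϖ (posIn b))) * ‖A‖ := fun b =>
    norm_apply_le_exp_neg δ' (ϖ ∘ posIn) A b
  calc Real.exp (δ' * (ϖ ∘ posOut) c) * ‖∑ b, k c b (A b)‖
      ≤ Real.exp (δ' * ϖ (posOut c)) * ∑ b, ‖k c b‖ * (Real.exp (-(δ' * ϖ (posIn b))) * ‖A‖) := by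
        refine mul_le_mul_of_nonneg_left ((norm_sum_le _ _).trans (Finset.sum_le_sum fun b _ => ?_))
          (Real.exp_pos _).le
        exact ((k c b).le_opNorm _).trans (mul_le_mul_of_nonneg_left (hcomp b) (norm_nonneg _))
    _ = (∑ b, Real.exp (δ' * ϖ (posOut c)) * ‖k c b‖ * Real.exp (-(δ' * ϖ (posIn b)))) * ‖A‖ := by
        rw [Finset.mul_sum, Finset.sum_mul]
        exact Finset.sum_congr rfl fun b _ => by ring
    _ ≤ c₀ * M * ‖A‖ :=
        mul_le_mul_of_nonneg_right (pinned_rowSum_le k ρ posIn posOut ϖ hc₀ hδ' hk hϖ hM c) (norm_nonneg _)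

/-- … hence the operator norm: `‖kerOpPin k δ′ (ϖ∘posIn) (ϖ∘posOut)‖ ≤ c₀·M`. [folklore] -/
theorem opNorm_kerOpPin_le (k : Λ' → Λ → (𝔄 →L[ℂ] 𝔅)) (ρ : S → S → ℝ) (posIn : Λ → S) (posOut : Λ' → S)
    (ϖ : S → ℝ) {c₀ δ δ' M : ℝ} (hc₀ : 0 ≤ c₀) (hδ' : 0 ≤ δ') (hM0 : 0 ≤ M)
    (hk : ∀ c b, ‖k c b‖ ≤ c₀ * Real.exp (-(δ * ρ (posOut c) (posIn b))))
    (hϖ : ∀ x y, ϖ x ≤ ϖ y + ρ x y)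
    (hM : ∀ x : S, ∑ b, Real.exp (-((δ - δ') * ρ x (posIn b))) ≤ M) :
    ‖kerOpPin k δ' (ϖ ∘ posIn) (ϖ ∘ posOut)‖ ≤ c₀ * M :=
  ContinuousLinearMap.opNorm_le_bound _ (by positivity)
    (norm_kerOpPin_apply_le k ρ posIn posOut ϖ hc₀ hδ' hM0 hk hϖ hM)

end Kernel

/-! ## §3 Located read-outs see the pin -/

section ReadOut

variable [Fintype Λ] [DecidableEq Λ]

/-- the truncation of a field to a finite support `s` (zero elsewhere) (file-private helper). [folklore] -/
private def trunc (s : Finset Λ) (A : Λ → 𝔄) : Λ → 𝔄 := fun b => if b ∈ s then A b else 0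

omit [Fintype Λ] [NormedSpace ℂ 𝔄] in
/-- On the support the truncation is the field. [folklore] -/
private theorem trunc_apply_of_mem {s : Finset Λ} {A : Λ → 𝔄} {b : Λ} (hb : b ∈ s) : trunc s A b = A b := by
  simp [trunc, hb]

omit [Fintype Λ] [NormedSpace ℂ 𝔄] in
/-- Truncation is additive: `trunc A − trunc A′ = trunc (A − A′)`. [folklore] -/
private theorem trunc_sub (s : Finset Λ) (A A' : Λ → 𝔄) : trunc s A - trunc s A' = trunc s (A - A') := by
  funext b
  by_cases hb : b ∈ s <;> simp [trunc, hb]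

/-- **THE TRUNCATION TO A SUPPORT AT PIN-DEPTH `≥ r` IS `e^{−δ′r}`-SMALL IN THE FLAT NORM**:
`‖trunc_s A‖_∞ ≤ e^{−δ′r}·‖A‖_pin` when `r ≤ ϖ b` on `s` and `δ′ ≥ 0`. [folklore] -/
theorem norm_trunc_le (s : Finset Λ) {δ' r : ℝ} (hδ' : 0 ≤ δ') (ϖ : Λ → ℝ) (hs : ∀ b ∈ s, r ≤ ϖ b)
    (A : WSup (pinW δ' ϖ) 1 𝔄) :
    ‖(fun b => if b ∈ s then A b else (0 : 𝔄))‖ ≤ Real.exp (-(δ' * r)) * ‖A‖ := by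
  refine (pi_norm_le_iff_of_nonneg (by positivity)).2 fun b => ?_
  by_cases hb : b ∈ s
  · rw [if_pos hb]
    refine (norm_apply_le_exp_neg δ' ϖ A b).trans (mul_le_mul_of_nonneg_right ?_ (norm_nonneg _))
    exact Real.exp_le_exp.2 (by nlinarith [hs b hb])
  · rw [if_neg hb, norm_zero]; positivity

/-- **A LINEAR READ-OUT BLIND OFF A LOCATED SUPPORT SEES THE PIN**: `ℓ` depends only on the components in `s`,
`r ≤ ϖ` on `s`, `δ′ ≥ 0` ⟹ `‖ℓ A‖ ≤ ‖ℓ‖·e^{−δ′r}·‖A‖_pin`. [folklore] -/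
theorem norm_readOut_le_of_blind (ℓ : (Λ → 𝔄) →L[ℂ] 𝔅) (s : Finset Λ)
    (hblind : ∀ A A' : Λ → 𝔄, (∀ b ∈ s, A b = A' b) → ℓ A = ℓ A')
    {δ' r : ℝ} (hδ' : 0 ≤ δ') (ϖ : Λ → ℝ) (hs : ∀ b ∈ s, r ≤ ϖ b) (A : WSup (pinW δ' ϖ) 1 𝔄) :
    ‖ℓ (WSup.toPiL (pinW δ' ϖ) 1 A)‖ ≤ ‖ℓ‖ * Real.exp (-(δ' * r)) * ‖A‖ := by
  have heq : ℓ (WSup.toPiL (pinW δ' ϖ) 1 A) = ℓ (fun b => if b ∈ s then A b else (0 : 𝔄)) :=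
    hblind _ _ fun b hb => by rw [WSup.toPiL_apply, if_pos hb]
  rw [heq, mul_assoc]
  exact (ℓ.le_opNorm _).trans (mul_le_mul_of_nonneg_left (norm_trunc_le s hδ' ϖ hs A) (norm_nonneg _))

omit [NormedSpace ℂ 𝔅] in
/-- **A LIPSCHITZ FUNCTIONAL BLIND OFF A LOCATED SUPPORT SEES THE PIN IN ITS OSCILLATION**: `φ` depends only on the
components in `s` and `‖φ A − φ A′‖ ≤ L·‖A − A′‖_∞` ⟹ `‖φ A − φ A′‖ ≤ L·e^{−δ′r}·‖A − A′‖_pin` — the shape in which a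
far plaquette letter or a far localized term reads the variation of the exponent field along the chart ray.
[folklore] -/
theorem norm_sub_le_of_blind_lipschitz (φ : (Λ → 𝔄) → 𝔅) (s : Finset Λ)
    (hblind : ∀ A A' : Λ → 𝔄, (∀ b ∈ s, A b = A' b) → φ A = φ A') {L : ℝ} (hL0 : 0 ≤ L)
    (hL : ∀ A A' : Λ → 𝔄, ‖φ A - φ A'‖ ≤ L * ‖A - A'‖)
    {δ' r : ℝ} (hδ' : 0 ≤ δ') (ϖ : Λ → ℝ) (hs : ∀ b ∈ s, r ≤ ϖ b) (A A' : WSup (pinW δ' ϖ) 1 𝔄) :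
    ‖φ (WSup.toPiL (pinW δ' ϖ) 1 A) - φ (WSup.toPiL (pinW δ' ϖ) 1 A')‖ ≤
      L * Real.exp (-(δ' * r)) * ‖A - A'‖ := by
  have hA : φ (WSup.toPiL (pinW δ' ϖ) 1 A) = φ (trunc s (WSup.toPiL (pinW δ' ϖ) 1 A)) :=
    hblind _ _ fun b hb => (trunc_apply_of_mem hb).symm
  have hA' : φ (WSup.toPiL (pinW δ' ϖ) 1 A') = φ (trunc s (WSup.toPiL (pinW δ' ϖ) 1 A')) :=
    hblind _ _ fun b hb => (trunc_apply_of_mem hb).symm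
  rw [hA, hA']
  refine (hL _ _).trans ?_
  rw [trunc_sub, mul_assoc]
  refine mul_le_mul_of_nonneg_left ?_ hL0
  have h := norm_trunc_le (𝔄 := 𝔄) s hδ' ϖ hs (A - A')
  have e : (fun b => if b ∈ s then (A - A') b else (0 : 𝔄)) =
      trunc s (WSup.toPiL (pinW δ' ϖ) 1 A - WSup.toPiL (pinW δ' ϖ) 1 A') := by
    funext b; rfl
  rw [e] at h
  exact h

end ReadOut

/-! ## §4 Located sums are volume-free -/

section Sums

/-- **THE BUDGET ALGEBRA**: per-index costs `L p ≤ ℓ₀e^{−δ′ϖP p}` against sizes `0 ≤ g p ≤ ḡ` with the located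
exponential sum `Σ_p e^{−δ′ϖP p} ≤ K` ⟹ `Σ_p L p·g p ≤ ℓ₀·ḡ·K`. [folklore] -/
theorem sum_mul_le_of_pinned {P : Type*} (Pw : Finset P) (L g : P → ℝ) (ϖP : P → ℝ) {ℓ₀ gbar δ' K : ℝ}
    (hℓ₀ : 0 ≤ ℓ₀) (hgbar : 0 ≤ gbar) (hL : ∀ p ∈ Pw, L p ≤ ℓ₀ * Real.exp (-(δ' * ϖP p)))
    (hg0 : ∀ p ∈ Pw, 0 ≤ g p) (hg : ∀ p ∈ Pw, g p ≤ gbar) (hK : ∑ p ∈ Pw, Real.exp (-(δ' * ϖP p)) ≤ K) :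
    ∑ p ∈ Pw, L p * g p ≤ ℓ₀ * gbar * K := by
  calc ∑ p ∈ Pw, L p * g p ≤ ∑ p ∈ Pw, ℓ₀ * Real.exp (-(δ' * ϖP p)) * gbar :=
        Finset.sum_le_sum fun p hp => mul_le_mul (hL p hp) (hg p hp) (hg0 p hp) (by positivity)
    _ = ℓ₀ * gbar * ∑ p ∈ Pw, Real.exp (-(δ' * ϖP p)) := by
        rw [Finset.mul_sum]; exact Finset.sum_congr rfl fun p _ => by ring
    _ ≤ ℓ₀ * gbar * K := mul_le_mul_of_nonneg_left hK (by positivity)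

variable {d T : ℕ} [NeZero T]

/-- **THE TORUS PIN** (DATA): the periodic ℓ¹-distance of a site to a nonempty finite site set `B₀` (the block's sites),
`pinDist B₀ x = min_{x₀ ∈ B₀} pl1(x − x₀)`. [folklore] -/
def pinDist (B₀ : Finset (TPt d T)) (hB₀ : B₀.Nonempty) (x : TPt d T) : ℝ :=
  B₀.inf' hB₀ fun x₀ => pl1 (x - x₀)

omit [NeZero T] in
/-- The torus pin is nonnegative. [folklore] -/
theorem pinDist_nonneg (B₀ : Finset (TPt d T)) (hB₀ : B₀.Nonempty) (x : TPt d T) : 0 ≤ pinDist B₀ hB₀ x :=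
  (Finset.le_inf'_iff hB₀ _).2 fun _ _ => pl1_nonneg _

/-- **THE TORUS PIN IS ONE-SIDED LIPSCHITZ** for the periodic ℓ¹ distance: `pinDist x ≤ pinDist y + pl1(x − y)` — the
hypothesis `hϖ` of §2 with `ρ x y = pl1 (x − y)`. [folklore] -/
theorem pinDist_le_add (B₀ : Finset (TPt d T)) (hB₀ : B₀.Nonempty) (x y : TPt d T) :
    pinDist B₀ hB₀ x ≤ pinDist B₀ hB₀ y + pl1 (x - y) := by
  obtain ⟨x₀, hx₀, hmin⟩ := Finset.exists_mem_eq_inf' hB₀ fun x₀ => pl1 (y - x₀)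
  unfold pinDist
  rw [hmin]
  calc B₀.inf' hB₀ (fun x₀ => pl1 (x - x₀)) ≤ pl1 (x - x₀) := Finset.inf'_le _ hx₀
    _ ≤ pl1 (x - y) + pl1 (y - x₀) := pl1_sub_triangle x y x₀
    _ = pl1 (y - x₀) + pl1 (x - y) := add_comm _ _

omit [NeZero T] in
/-- `e^{−δ′·pinDist x} ≤ Σ_{x₀ ∈ B₀} e^{−δ′·pl1(x − x₀)}` (the minimum is attained; the other summands are `≥ 0`).
[folklore] -/
theorem exp_neg_pinDist_le_sum (B₀ : Finset (TPt d T)) (hB₀ : B₀.Nonempty) (δ' : ℝ) (x : TPt d T) :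
    Real.exp (-(δ' * pinDist B₀ hB₀ x)) ≤ ∑ x₀ ∈ B₀, Real.exp (-(δ' * pl1 (x - x₀))) := by
  obtain ⟨x₀, hx₀, hmin⟩ := Finset.exists_mem_eq_inf' hB₀ fun x₀ => pl1 (x - x₀)
  unfold pinDist
  rw [hmin]
  exact Finset.single_le_sum (f := fun x₀ => Real.exp (-(δ' * pl1 (x - x₀)))) (fun _ _ => (Real.exp_pos _).le) hx₀

/-- **LOCATED SUMS ON THE TORUS ARE VOLUME-FREE**: for indices placed by `pos : P → (ℤ∕Tℤ)ᵈ` with at most `m` per site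
and `δ′ > 0`, `Σ_p e^{−δ′·pinDist B₀ (pos p)} ≤ #B₀·m·K₁ d δ′` — NO `#P`, NO `T`. [folklore] -/
theorem sum_exp_neg_pinDist_le {P : Type*} [Fintype P] (pos : P → TPt d T) {m : ℕ}
    (hm : ∀ x, (Finset.univ.filter fun p => pos p = x).card ≤ m) (B₀ : Finset (TPt d T)) (hB₀ : B₀.Nonempty)
    {δ' : ℝ} (hδ' : 0 < δ') :
    ∑ p, Real.exp (-(δ' * pinDist B₀ hB₀ (pos p))) ≤ B₀.card * (m * K₁ d δ') := by
  calc ∑ p, Real.exp (-(δ' * pinDist B₀ hB₀ (pos p)))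
      ≤ ∑ p, ∑ x₀ ∈ B₀, Real.exp (-(δ' * pl1 (pos p - x₀))) :=
        Finset.sum_le_sum fun p _ => exp_neg_pinDist_le_sum B₀ hB₀ δ' (pos p)
    _ = ∑ x₀ ∈ B₀, ∑ p, Real.exp (-(δ' * pl1 (pos p - x₀))) := Finset.sum_comm
    _ ≤ ∑ _x₀ ∈ B₀, (m : ℝ) * K₁ d δ' := Finset.sum_le_sum fun x₀ _ => sum_exp_pl1_comp_le' pos hm hδ' x₀
    _ = B₀.card * (m * K₁ d δ') := by rw [Finset.sum_const, nsmul_eq_mul]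

end Sums

/-! ## §5 The END shape: `slotAntiConcentration_of_levelData`'s per-plaquette constant, pinned, is volume-free -/

section EndShape

/-- **THE WEIGHT BUDGET**: with pinned Lipschitz data `L̄_p ≤ ℓ₀e^{−δ′ϖ(p)}`, sizes `0 ≤ s̄_p ≤ s̄`, frozen deviations
`0 ≤ d̄_p ≤ d̄` and the located sum `Σ_p e^{−δ′ϖ(p)} ≤ K`, `ShellMeasureLevelAssembly`'s Wilson ray cost obeys
`Σ_{p∈P_w} L̄_p(d̄_p + 4s̄_p) ≤ ℓ₀·(d̄ + 4s̄)·K` for ANY finite `P_w`. [folklore] -/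
theorem weightBudget_le {κ : Type*} (Pw : Finset κ) (lw dw sw : κ → ℝ) (ϖP : κ → ℝ) {ℓ₀ dbar sbar δ' K : ℝ}
    (hℓ₀ : 0 ≤ ℓ₀) (hdbar : 0 ≤ dbar) (hsbar : 0 ≤ sbar)
    (hlw : ∀ p ∈ Pw, lw p ≤ ℓ₀ * Real.exp (-(δ' * ϖP p)))
    (hdw0 : ∀ p ∈ Pw, 0 ≤ dw p) (hdw : ∀ p ∈ Pw, dw p ≤ dbar) (hsw0 : ∀ p ∈ Pw, 0 ≤ sw p) (hsw : ∀ p ∈ Pw, sw p ≤ sbar)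
    (hK : ∑ p ∈ Pw, Real.exp (-(δ' * ϖP p)) ≤ K) :
    ∑ p ∈ Pw, lw p * (dw p + 4 * sw p) ≤ ℓ₀ * (dbar + 4 * sbar) * K :=
  sum_mul_le_of_pinned Pw lw (fun p => dw p + 4 * sw p) ϖP hℓ₀ (by positivity) hlw
    (fun p hp => by have := hdw0 p hp; have := hsw0 p hp; positivity)
    (fun p hp => by linarith [hdw p hp, hsw p hp]) hK

/-- **(M1) WITH THE VOLUME-FREE CONSTANT.**  `ShellMeasureLevelAssembly.slotAntiConcentration_of_levelData` concludes
`SlotAntiConcentration μ′ u θ ρ (2(n + (β Σ_{p∈P_w} L̄_p(d̄_p + 4s̄_p) + B_𝓔))∕(1−δ))` for ANY finite weight-plaquette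
set `P_w` with PER-PLAQUETTE data; under the pinned hypotheses of `weightBudget_le` (far plaquettes' ray-Lipschitz
constants decay with the distance to the block) the constant passes to `2(n + (β·ℓ₀(d̄ + 4s̄)·K + B_𝓔))∕(1−δ)` — all
plaquettes of the action admitted, NO volume (`slotAntiConcentration_mono`).  The pinned data themselves are the
locality road's located inputs (rows S70∕S71); nothing is discharged. [folklore] -/
theorem slotAntiConcentration_pinned {Ω : Type*} [MeasurableSpace Ω] {μ' : MeasureTheory.Measure Ω} {u : Ω → ℝ}
    {κ : Type*} (Pw : Finset κ) (lw dw sw : κ → ℝ) (ϖP : κ → ℝ) {n β B𝓔 θ ρ δ ℓ₀ dbar sbar δ' K : ℝ}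
    (hβ : 0 ≤ β) (hρ : 0 ≤ ρ) (hδ1 : δ < 1) (hℓ₀ : 0 ≤ ℓ₀) (hdbar : 0 ≤ dbar) (hsbar : 0 ≤ sbar)
    (hlw : ∀ p ∈ Pw, lw p ≤ ℓ₀ * Real.exp (-(δ' * ϖP p)))
    (hdw0 : ∀ p ∈ Pw, 0 ≤ dw p) (hdw : ∀ p ∈ Pw, dw p ≤ dbar) (hsw0 : ∀ p ∈ Pw, 0 ≤ sw p) (hsw : ∀ p ∈ Pw, sw p ≤ sbar)
    (hK : ∑ p ∈ Pw, Real.exp (-(δ' * ϖP p)) ≤ K)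
    (h : SlotAntiConcentration μ' u θ ρ (2 * (n + (β * ∑ p ∈ Pw, lw p * (dw p + 4 * sw p) + B𝓔)) / (1 - δ))) :
    SlotAntiConcentration μ' u θ ρ (2 * (n + (β * (ℓ₀ * (dbar + 4 * sbar) * K) + B𝓔)) / (1 - δ)) := by
  refine slotAntiConcentration_mono hρ ?_ h
  have h1δ : 0 < 1 - δ := by linarith
  have hW := weightBudget_le Pw lw dw sw ϖP hℓ₀ hdbar hsbar hlw hdw0 hdw hsw0 hsw hK
  have h2 : β * ∑ p ∈ Pw, lw p * (dw p + 4 * sw p) ≤ β * (ℓ₀ * (dbar + 4 * sbar) * K) :=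
    mul_le_mul_of_nonneg_left hW hβ
  exact div_le_div_of_nonneg_right (by linarith) h1δ.le

end EndShape

end Summit.QuantumFields.BalabanUV.T4Continuum.ShellMeasurePinnedNorm

end
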